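import Mathlib
import HarnessLib

/-!
# Shift-set pseudo-flows: three scalar selection steps forced by the backscatter classes (top flux,
  bottom flux, tail slowness; helper for item stmt-NavierStokesRegularity-22988
  `GappedFrontRobustV2Flat`, crux K_B♭ of route TaoLadderRungTwoFlat)

Pure real-number lemmas used by the constants selection `gappedFrontRobustV2On_closeness`
(`…V2ClosenessOn`). On a two-way nearest-neighbour shift set each boundary flux of the front block
has, besides the one-way term, a backscatter term with two factors above the bond, and the tail step
carries an exponential `exp((1+ε₀)^{5(K−1)/2} C c P)`; the three lemmas here turn the thresholds
delivered by the `S` selection lemmas (`GappedFrontRobust.exists_top_shell`,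
`GappedFrontRobust.exists_kb_bottom_flux`) into the `𝕊`-shaped conditions of
`GappedFrontRobustOn.stepCloseness_core`:
* `topflux_of_top_shell`: `q^{5kt/2}/w(kt) ≤ 1/(4c·X + 4)`, `X = C (4√(2K)r + 4Kr²)`, `w(kt) ≥ 1` ⇒
  `c (q^{5kt/2} C (4A + 2A²)) ≤ 1/4` with `A = √(2K) r / w(kt)`;
* `botflux_of_two_le`: `c (q^{5kb/2} G² · 2 · (2C)) ≤ 1/4` and `G ≥ 2` ⇒ `c (q^{5kb/2} C (2G² + 4G)) ≤ 1/4`;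
* `slow_of_top_shell`: `q^{5(K−2)/2}/w(K−2) ≤ 1/(2 q^{5/2} C c M r + 2)`, `0 ≤ x ≤ M` ⇒
  `q^{5(K−1)/2} C c (x r / w(K−2)) ≤ 1/2`.

HONEST FRAMING: elementary real-number bookkeeping; nothing is asserted about any table or flow; nothing
here concerns the Navier–Stokes equations (p1 g12).
-/

noncomputable section

-- the sub-problem namespace `Summit.NavierStokesRegularity.NavierStokesRegularity` repeats the summit name by design (D-0017)
set_option linter.dupNamespace false

namespace Summit.NavierStokesRegularity.NavierStokesRegularity.Theorems

namespace GappedFrontRobustOn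

/-- **Top flux from the top-shell threshold** (one-way + backscatter parts). [folklore] -/
theorem topflux_of_top_shell {q c C K r wkt kt : ℝ} (hq : 0 < q) (hc : 0 < c) (hC : 0 ≤ C)
    (hK : 0 ≤ K) (hr : 0 < r) (hw1 : 1 ≤ wkt)
    (h1 : q ^ ((5 : ℝ) * kt / 2) / wkt ≤ 1 / (4 * c * (C * (4 * (Real.sqrt (2 * K) * r) + 4 * (K * r ^ 2))) + 4)) :
    c * (q ^ ((5 : ℝ) * kt / 2) * C *
      (4 * (Real.sqrt (2 * K) * r / wkt) + 2 * (Real.sqrt (2 * K) * r / wkt) ^ 2)) ≤ 1 / 4 := by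
  have hwkt : 0 < wkt := lt_of_lt_of_le one_pos hw1
  set X : ℝ := C * (4 * (Real.sqrt (2 * K) * r) + 4 * (K * r ^ 2)) with hX
  have hX0 : 0 ≤ X := by positivity
  set Q : ℝ := q ^ ((5 : ℝ) * kt / 2) with hQ
  have hQ0 : 0 ≤ Q := (Real.rpow_pos_of_pos hq _).le
  have h2 : Q / wkt ^ 2 ≤ Q / wkt := by
    apply div_le_div_of_nonneg_left hQ0 hwkt
    nlinarith
  have hsq : (Real.sqrt (2 * K) * r / wkt) ^ 2 = 2 * K * r ^ 2 / wkt ^ 2 := by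
    rw [div_pow, mul_pow, Real.sq_sqrt (by positivity)]
  have e1 : c * (Q * C * (4 * (Real.sqrt (2 * K) * r / wkt) + 2 * (Real.sqrt (2 * K) * r / wkt) ^ 2)) =
      c * C * (4 * (Real.sqrt (2 * K) * r) * (Q / wkt) + 4 * (K * r ^ 2) * (Q / wkt ^ 2)) := by
    rw [hsq]; field_simp; ring
  rw [e1]
  have ha : 0 ≤ 4 * (Real.sqrt (2 * K) * r) := by positivity
  have hb : 0 ≤ 4 * (K * r ^ 2) := by positivity
  have h4 : Q / wkt ^ 2 ≤ 1 / (4 * c * X + 4) := h2.trans h1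
  have h3 : 4 * (Real.sqrt (2 * K) * r) * (Q / wkt) + 4 * (K * r ^ 2) * (Q / wkt ^ 2) ≤
      (4 * (Real.sqrt (2 * K) * r) + 4 * (K * r ^ 2)) * (1 / (4 * c * X + 4)) := by
    nlinarith [mul_le_mul_of_nonneg_left h1 ha, mul_le_mul_of_nonneg_left h4 hb]
  have hpos : 0 < 4 * c * X + 4 := by positivity
  calc c * C * (4 * (Real.sqrt (2 * K) * r) * (Q / wkt) + 4 * (K * r ^ 2) * (Q / wkt ^ 2))
      ≤ c * C * ((4 * (Real.sqrt (2 * K) * r) + 4 * (K * r ^ 2)) * (1 / (4 * c * X + 4))) :=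
        mul_le_mul_of_nonneg_left h3 (by positivity)
    _ = c * X * (1 / (4 * c * X + 4)) := by rw [hX]; ring
    _ ≤ 1 / 4 := by
        rw [mul_one_div, div_le_iff₀ hpos]
        nlinarith [mul_nonneg hc.le hX0]

/-- **Bottom flux from the one-way threshold when the neighbour envelope is `≥ 2`** (the linear
backscatter term is absorbed into the quadratic one). [folklore] -/
theorem botflux_of_two_le {q c C G kb : ℝ} (hq : 0 < q) (hc : 0 ≤ c) (hC : 0 ≤ C) (hG2 : 2 ≤ G)
    (h1 : c * ((1 : ℝ) * q ^ ((5 : ℝ) * kb / 2) * G ^ 2 * 2 * (2 * C)) ≤ 1 / 4) :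
    c * (q ^ ((5 : ℝ) * kb / 2) * C * (2 * G ^ 2 + 4 * G)) ≤ 1 / 4 := by
  have hQ0 : 0 ≤ q ^ ((5 : ℝ) * kb / 2) := (Real.rpow_pos_of_pos hq _).le
  have h3 : 2 * G ^ 2 + 4 * G ≤ 4 * G ^ 2 := by nlinarith
  calc c * (q ^ ((5 : ℝ) * kb / 2) * C * (2 * G ^ 2 + 4 * G))
      ≤ c * (q ^ ((5 : ℝ) * kb / 2) * C * (4 * G ^ 2)) :=
        mul_le_mul_of_nonneg_left (mul_le_mul_of_nonneg_left h3 (mul_nonneg hQ0 hC)) hc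
    _ = c * ((1 : ℝ) * q ^ ((5 : ℝ) * kb / 2) * G ^ 2 * 2 * (2 * C)) := by ring
    _ ≤ 1 / 4 := h1

/-- **Tail slowness from a top-shell threshold two shells down.** [folklore] -/
theorem slow_of_top_shell {q c C M r x wK2 : ℝ} {K : ℤ} (hq : 0 < q) (hc : 0 ≤ c) (hC : 0 ≤ C)
    (hM : 0 ≤ M) (hr : 0 ≤ r) (hx0 : 0 ≤ x) (hxM : x ≤ M)
    (h1 : q ^ ((5 : ℝ) * ((K - 2 : ℤ) : ℝ) / 2) / wK2 ≤
      1 / (2 * (q ^ ((5 : ℝ) / 2) * C * c * M * r) + 2)) :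
    q ^ ((5 : ℝ) * ((K - 1 : ℤ) : ℝ) / 2) * C * c * (x * r / wK2) ≤ 1 / 2 := by
  have hq52 : 0 < q ^ ((5 : ℝ) / 2) := Real.rpow_pos_of_pos hq _
  have hsplit : q ^ ((5 : ℝ) * ((K - 1 : ℤ) : ℝ) / 2) =
      q ^ ((5 : ℝ) / 2) * q ^ ((5 : ℝ) * ((K - 2 : ℤ) : ℝ) / 2) := by
    rw [← Real.rpow_add hq]; congr 1; push_cast; ring
  rw [hsplit]
  set Q : ℝ := q ^ ((5 : ℝ) * ((K - 2 : ℤ) : ℝ) / 2) with hQ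
  have e : q ^ ((5 : ℝ) / 2) * Q * C * c * (x * r / wK2) =
      (q ^ ((5 : ℝ) / 2) * C * c * x * r) * (Q / wK2) := by ring
  rw [e]
  have hfac : 0 ≤ q ^ ((5 : ℝ) / 2) * C * c * x * r := by positivity
  have hfacM : q ^ ((5 : ℝ) / 2) * C * c * x * r ≤ q ^ ((5 : ℝ) / 2) * C * c * M * r :=
    mul_le_mul_of_nonneg_right (mul_le_mul_of_nonneg_left hxM (by positivity)) hr
  have hpos : 0 < 2 * (q ^ ((5 : ℝ) / 2) * C * c * M * r) + 2 := by positivity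
  have hε0 : 0 ≤ 1 / (2 * (q ^ ((5 : ℝ) / 2) * C * c * M * r) + 2) := by positivity
  calc (q ^ ((5 : ℝ) / 2) * C * c * x * r) * (Q / wK2)
      ≤ (q ^ ((5 : ℝ) / 2) * C * c * x * r) * (1 / (2 * (q ^ ((5 : ℝ) / 2) * C * c * M * r) + 2)) :=
        mul_le_mul_of_nonneg_left h1 hfac
    _ ≤ (q ^ ((5 : ℝ) / 2) * C * c * M * r) * (1 / (2 * (q ^ ((5 : ℝ) / 2) * C * c * M * r) + 2)) :=
        mul_le_mul_of_nonneg_right hfacM hε0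
    _ ≤ 1 / 2 := by
        rw [mul_one_div, div_le_iff₀ hpos]
        nlinarith [mul_nonneg (mul_nonneg (mul_nonneg (mul_nonneg hq52.le hC) hc) hM) hr]

/-- **The factor-2 closing condition from the `S` closing lemma with `(m, C) := (4m, 2C)`**:
`√(4/3 · 4m · X) = 2 √(4/3 · m · X)`. [folklore] -/
theorem two_mul_close_of {m X d C e ν : ℝ}
    (h : Real.sqrt 2 * Real.sqrt (4 / 3 * (4 * m) * X) / d + 2 * C * e ≤ ν) :
    2 * (Real.sqrt 2 * Real.sqrt (4 / 3 * m * X) / d + C * e) ≤ ν := by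
  have hsq : Real.sqrt (4 / 3 * (4 * m) * X) = 2 * Real.sqrt (4 / 3 * m * X) := by
    rw [show 4 / 3 * (4 * m) * X = 2 ^ 2 * (4 / 3 * m * X) by ring, Real.sqrt_mul (by norm_num),
      Real.sqrt_sq (by norm_num)]
  rw [hsq] at h
  have e : 2 * (Real.sqrt 2 * Real.sqrt (4 / 3 * m * X) / d + C * e) =
      Real.sqrt 2 * (2 * Real.sqrt (4 / 3 * m * X)) / d + 2 * C * e := by ring
  rw [e]; exact h

end GappedFrontRobustOn

end Summit.NavierStokesRegularity.NavierStokesRegularity.Theorems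

end
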